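import Summits.BirchSwinnertonDyer.BirchSwinnertonDyer.Theorems.PrintX9HowardContainmentPinnedOfSixLeaves
import HarnessLib

/-!
# T-KS9 — closer of the closes⁶ A-side glue item `PrintX9.HowardContainmentLightFramePinnedOfKSLeaves`

One line over x9-p1 LEAD g7's three-leaf theorem (p695713).  Land with
`ledger propose --kind proof --target Summits/BirchSwinnertonDyer/BirchSwinnertonDyer/Theorems/PrintX9HowardContainmentPinnedOfKSLeavesEntry.lean
 --file PrintX9KSLeavesEntry.lean --workitem <id of HowardContainmentLightFramePinnedOfKSLeaves>` AFTER the pen's «PrintX9 REWRITTEN» line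
(the def must exist in `Theses/PrintX9.lean`).  CONDITIONAL on nothing new: the item is GLUE; the three print leaves stay hypotheses of
`closes`.  BSD is not proved by this. [cite: Howard2004HeegnerKolyvagin, Thm. 1.6.1] [cite: CastellaGrossiLeeSkinner2022, Thm. 4.1.1]
[cite: CastellaGrossiSkinner2025, Thm. 6.5.2]
-/

set_option linter.dupNamespace false

namespace Summit.BirchSwinnertonDyer.BirchSwinnertonDyer.Theorems.PrintX9KSLeavesEntry

open Summit.BirchSwinnertonDyer.BirchSwinnertonDyer.Theses.PrintX9

/-- `HowardContainmentLightFramePinnedOfKSLeaves` holds: the pinned Howard containment on every rank-one light X9 frame from the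
three cite-only leaves F-161 / F-411 / CGS 6.5.2 (p695713). [cite: Howard2004HeegnerKolyvagin, Thm. 1.6.1]
[cite: CastellaGrossiLeeSkinner2022, Thm. 4.1.1] [cite: CastellaGrossiSkinner2025, Thm. 6.5.2] -/
theorem howardContainmentLightFramePinnedOfKSLeaves_holds : HowardContainmentLightFramePinnedOfKSLeaves :=
  fun hH hK hCGS =>
    PrintX9OfKolyvaginSystemLeaf.howardContainmentLightFramePinned_of_howard_kolyvaginSystem_cgs hH hK hCGS

end Summit.BirchSwinnertonDyer.BirchSwinnertonDyer.Theorems.PrintX9KSLeavesEntry
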